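import Summits.QuantumFields.YangMills.Theorems.VirialFluxGapSharpTwistedLaplaceAssembly
import Summits.QuantumFields.YangMills.Theorems.VirialFluxGapSharpTwistedLaplaceQuantitativeLaplaceOrbit
import Summits.QuantumFields.YangMills.Theorems.VirialFluxGapRingTreeGauge
import HarnessLib

/-!
# ⟨stmt-QuantumFields-24204⟩ `SharpTwistedLaplace` FROM per-tube estimates on the tree-gauged space and an off-tube floor
# (layer (D) of the DIRECT Laplace road, complete: everything generic is now proved; what is left is per-tube chart data)

Helper module (free-hands work of width seat ym-line-sfw-p2-w2 g49, cell ym-idea-1).  With `X_fix(L) = SU2^{off-tree} × (GaugeConfig 3 L SU2)^{2L−1}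
× SU2^{sites}`, `μ_fix` the product Haar probability and `F_fix(w, (f, g)) = F_z(glue w ∷ f, g)`:
* `integral_exp_neg_ringDeficit_eq_fix` — `∫ e^{−βF_z} d(ringMeasure L) = ∫_{X_fix} e^{−βF_fix} dμ_fix` (✓`integral_ringMeasure_eq_treeGauge` + Fubini);
* ★★ `sharpTwistedLaplace_of_fixTubes` — if for every `L ≥ L₁`, `z ≠ 0` there are finitely many pairwise disjoint measurable TUBES
  `T_a ⊂ X_fix` with the per-tube estimates `|∫_{T_a} e^{−βF_fix} dμ_fix − c_a(2π/β)^{9L⁴}| ≤ (K_a/β)c_a(2π/β)^{9L⁴}` (`β ≥ 1`; literally the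
  output of ✓`laplaceMethod_quantitative_orbit_tube` with `ν(K)·w₀/√det A = c_a`) and the off-tube FLOOR `F_fix ≥ η` off `⋃_a T_a`, all constants
  polynomial in `L` (`K_a ≤ AL^p`, `|log Σc_a| ≤ AL^p`, `η ≥ 1/(AL^p)`), then `Summit.QuantumFields.YangMills.Theses.VirialFluxGap.SharpTwistedLaplace`
  (✓`laplaceMethod_quantitative_sum_of_tubes` + ✓`sharpTwistedLaplace_of_tubeAsymptotics`).
REMAINING for the leaf (memo v5 §9): per sign class, the tube `T_s = SU(2)·σ_s(B_R)` with its chart data (B2∕B3) and the floor transfer of ✓⟨24320⟩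
to `X_fix`.  Everything here is PROVED; no definitions, no named facts.  HONEST FRAMING: CONDITIONAL assembly; ⟨24204⟩, ⟨24319⟩ and every rung stay
OPEN; the Yang–Mills mass gap (Clay) is NOT touched; no summit is proved by a line.
-/

noncomputable section

open Real Finset MeasureTheory Set
open scoped BigOperators ENNReal
open Literature.MathematicalPhysics.QuantumFieldTheory hiding SU2
open Literature.MathematicalPhysics.QuantumLattice
open Summit.QuantumFields.YangMills.Theorems.FemtoTransferGap
open Summit.QuantumFields.YangMills.Theorems.FemtoTransferGap.TT
open Summit.QuantumFields.YangMills.Theorems.VirialFluxGap.RingDeficit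

namespace Summit.QuantumFields.YangMills.Theorems.QuantitativeLaplace

variable {L : ℕ} [NeZero L]

/-! ## §1 The ring integral on the tree-gauged space -/

/-- The reduced phase `F_fix(w, (f, g)) = F_z(glue w ∷ f, g)` is measurable. [folklore] -/
theorem measurable_ringDeficit_fix (z : Fin 3 → Bool) :
    Measurable fun x : (OffIdx L → SU2) × ((Fin (2 * L - 1) → GaugeConfig 3 L SU2) × (Site 3 L → SU2)) =>
      ringDeficit L z ((Fin.cons (glue x.1) x.2.1 : Fin (2 * L - 1 + 1) → GaugeConfig 3 L SU2), x.2.2) :=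
  (measurable_ringDeficit z).comp (measurable_ringCons.comp ((measurable_glue.comp measurable_fst).prodMk measurable_snd))

/-- ★ `∫ e^{−βF_z} d(ringMeasure L) = ∫_{X_fix} e^{−βF_fix} dμ_fix` for `0 ≤ β`. [cite: SeilerLNP1982, §2] -/
theorem integral_exp_neg_ringDeficit_eq_fix (z : Fin 3 → Bool) {β : ℝ} (hβ : 0 ≤ β) :
    ∫ P, Real.exp (-(β * ringDeficit L z P)) ∂(ringMeasure L) =
      ∫ x, Real.exp (-(β * ringDeficit L z ((Fin.cons (glue x.1) x.2.1 : Fin (2 * L - 1 + 1) → GaugeConfig 3 L SU2), x.2.2)))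
        ∂((Measure.pi fun _ : OffIdx L => haarProbability SU2).prod
          ((Measure.pi fun _ : Fin (2 * L - 1) => configMeasure SU2 L).prod (gaugeMeasure L))) := by
  haveI : IsProbabilityMeasure (gaugeMeasure L) := by unfold gaugeMeasure; infer_instance
  have hGm : Measurable fun P : (Fin (2 * L - 1 + 1) → GaugeConfig 3 L SU2) × (Site 3 L → SU2) =>
      Real.exp (-(β * ringDeficit L z P)) := ((measurable_ringDeficit z).const_mul β).neg.exp
  have h0 : ∀ P : (Fin (2 * L - 1 + 1) → GaugeConfig 3 L SU2) × (Site 3 L → SU2), 0 ≤ Real.exp (-(β * ringDeficit L z P)) :=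
    fun P => (Real.exp_pos _).le
  have h1 : ∀ P : (Fin (2 * L - 1 + 1) → GaugeConfig 3 L SU2) × (Site 3 L → SU2), Real.exp (-(β * ringDeficit L z P)) ≤ 1 :=
    fun P => Real.exp_le_one_iff.mpr (by have := ringDeficit_nonneg z P; nlinarith)
  rw [integral_ringMeasure_eq_treeGauge hGm (fun h P => by rw [ringDeficit_ringGaugeAct z h P]) h0 h1]
  have hFm := ((measurable_ringDeficit_fix (L := L) z).const_mul β).neg.exp
  have hFi : Integrable (fun x : (OffIdx L → SU2) × ((Fin (2 * L - 1) → GaugeConfig 3 L SU2) × (Site 3 L → SU2)) =>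
      Real.exp (-(β * ringDeficit L z ((Fin.cons (glue x.1) x.2.1 : Fin (2 * L - 1 + 1) → GaugeConfig 3 L SU2), x.2.2))))
      ((Measure.pi fun _ : OffIdx L => haarProbability SU2).prod
        ((Measure.pi fun _ : Fin (2 * L - 1) => configMeasure SU2 L).prod (gaugeMeasure L))) :=
    Integrable.of_bound hFm.aestronglyMeasurable 1 (Filter.Eventually.of_forall fun x => by
      rw [Real.norm_eq_abs, abs_of_nonneg (h0 _)]; exact h1 _)
  exact (integral_prod _ hFi).symm

/-! ## §2 The crux by name from per-tube estimates on `X_fix` and an off-tube floor -/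

/-- ★★ **⟨stmt-QuantumFields-24204⟩ `SharpTwistedLaplace` from per-tube estimates on the tree-gauged space and an off-tube floor**, all constants
polynomial in `L`.  CONDITIONAL assembly: hypotheses `htube` (B2∕B3 via ✓`laplaceMethod_quantitative_orbit_tube`) and `hfloor` (✓⟨24320⟩ transferred
to `X_fix`) are what remains. [cite: Luscher1983, §2] [cite: Breitung1994, Thm 41 p. 56; Thm 56 (6.31)] -/
theorem sharpTwistedLaplace_of_fixTubes {ι : Type*} [Fintype ι] [Nonempty ι]
    {c K : ℕ → (Fin 3 → Bool) → ι → ℝ} {η : ℕ → (Fin 3 → Bool) → ℝ} {A : ℝ} {p L₁ : ℕ} (hA : 1 ≤ A)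
    (hc : ∀ (L : ℕ) (z : Fin 3 → Bool) (a : ι), L₁ ≤ L → z ≠ (fun _ => false) → 0 < c L z a)
    (hK : ∀ (L : ℕ) (z : Fin 3 → Bool) (a : ι), L₁ ≤ L → z ≠ (fun _ => false) → K L z a ≤ A * (L : ℝ) ^ p)
    (hΛ : ∀ (L : ℕ) (z : Fin 3 → Bool), L₁ ≤ L → z ≠ (fun _ => false) → |Real.log (∑ a, c L z a)| ≤ A * (L : ℝ) ^ p)
    (hη : ∀ (L : ℕ) (z : Fin 3 → Bool), L₁ ≤ L → z ≠ (fun _ => false) → 1 / (A * (L : ℝ) ^ p) ≤ η L z)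
    (T : (L : ℕ) → (Fin 3 → Bool) → ι →
      Set ((OffIdx L → SU2) × ((Fin (2 * L - 1) → GaugeConfig 3 L SU2) × (Site 3 L → SU2))))
    (hTm : ∀ (L : ℕ) (z : Fin 3 → Bool) (a : ι), L₁ ≤ L → z ≠ (fun _ => false) → MeasurableSet (T L z a))
    (hdisj : ∀ (L : ℕ) (z : Fin 3 → Bool), L₁ ≤ L → z ≠ (fun _ => false) → Pairwise fun a b => Disjoint (T L z a) (T L z b))
    (htube : ∀ (β : ℝ) (L : ℕ) [NeZero L] (z : Fin 3 → Bool) (a : ι), 1 ≤ β → L₁ ≤ L → z ≠ (fun _ => false) →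
      |(∫ x in T L z a, Real.exp (-(β * ringDeficit L z
          ((Fin.cons (glue x.1) x.2.1 : Fin (2 * L - 1 + 1) → GaugeConfig 3 L SU2), x.2.2)))
          ∂((Measure.pi fun _ : OffIdx L => haarProbability SU2).prod
            ((Measure.pi fun _ : Fin (2 * L - 1) => configMeasure SU2 L).prod (gaugeMeasure L)))) -
        c L z a * (2 * π / β) ^ ((9 : ℝ) * (L : ℝ) ^ 4)| ≤ K L z a / β * (c L z a * (2 * π / β) ^ ((9 : ℝ) * (L : ℝ) ^ 4)))
    (hfloor : ∀ (L : ℕ) [NeZero L] (z : Fin 3 → Bool), L₁ ≤ L → z ≠ (fun _ => false) →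
      ∀ x : (OffIdx L → SU2) × ((Fin (2 * L - 1) → GaugeConfig 3 L SU2) × (Site 3 L → SU2)), x ∉ (⋃ a, T L z a) →
        η L z ≤ ringDeficit L z ((Fin.cons (glue x.1) x.2.1 : Fin (2 * L - 1 + 1) → GaugeConfig 3 L SU2), x.2.2)) :
    Summit.QuantumFields.YangMills.Theses.VirialFluxGap.SharpTwistedLaplace := by
  refine sharpTwistedLaplace_of_tubeAsymptotics (ι := ι) hA hc hK hΛ hη fun β L _ z hβ hL hz => ?_
  haveI : IsProbabilityMeasure (gaugeMeasure L) := by unfold gaugeMeasure; infer_instance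
  have hβ0 : 0 ≤ β := by linarith
  rw [integral_exp_neg_ringDeficit_eq_fix z hβ0]
  set μ : Measure ((OffIdx L → SU2) × ((Fin (2 * L - 1) → GaugeConfig 3 L SU2) × (Site 3 L → SU2))) :=
    (Measure.pi fun _ : OffIdx L => haarProbability SU2).prod
      ((Measure.pi fun _ : Fin (2 * L - 1) => configMeasure SU2 L).prod (gaugeMeasure L)) with hμ
  have hFm : Measurable fun x : (OffIdx L → SU2) × ((Fin (2 * L - 1) → GaugeConfig 3 L SU2) × (Site 3 L → SU2)) =>
      Real.exp (-(β * ringDeficit L z ((Fin.cons (glue x.1) x.2.1 : Fin (2 * L - 1 + 1) → GaugeConfig 3 L SU2), x.2.2))) :=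
    ((measurable_ringDeficit_fix (L := L) z).const_mul β).neg.exp
  have h0 : ∀ x : (OffIdx L → SU2) × ((Fin (2 * L - 1) → GaugeConfig 3 L SU2) × (Site 3 L → SU2)),
      0 ≤ Real.exp (-(β * ringDeficit L z ((Fin.cons (glue x.1) x.2.1 : Fin (2 * L - 1 + 1) → GaugeConfig 3 L SU2), x.2.2))) :=
    fun x => (Real.exp_pos _).le
  have h1 : ∀ x : (OffIdx L → SU2) × ((Fin (2 * L - 1) → GaugeConfig 3 L SU2) × (Site 3 L → SU2)),
      Real.exp (-(β * ringDeficit L z ((Fin.cons (glue x.1) x.2.1 : Fin (2 * L - 1 + 1) → GaugeConfig 3 L SU2), x.2.2))) ≤ 1 :=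
    fun x => Real.exp_le_one_iff.mpr (by
      nlinarith [ringDeficit_nonneg z ((Fin.cons (glue x.1) x.2.1 : Fin (2 * L - 1 + 1) → GaugeConfig 3 L SU2), x.2.2)])
  have hFi : Integrable (fun x : (OffIdx L → SU2) × ((Fin (2 * L - 1) → GaugeConfig 3 L SU2) × (Site 3 L → SU2)) =>
      Real.exp (-(β * ringDeficit L z ((Fin.cons (glue x.1) x.2.1 : Fin (2 * L - 1 + 1) → GaugeConfig 3 L SU2), x.2.2)))) μ :=
    Integrable.of_bound hFm.aestronglyMeasurable 1 (Filter.Eventually.of_forall fun x => by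
      rw [Real.norm_eq_abs, abs_of_nonneg (h0 _)]; exact h1 _)
  have hout : ∀ x, x ∉ (⋃ a, T L z a) →
      |Real.exp (-(β * ringDeficit L z ((Fin.cons (glue x.1) x.2.1 : Fin (2 * L - 1 + 1) → GaugeConfig 3 L SU2), x.2.2)))| ≤
        Real.exp (-(β * η L z)) := by
    intro x hx
    rw [abs_of_nonneg (h0 x), Real.exp_le_exp]
    have := hfloor L z hL hz x hx
    nlinarith
  have h := laplaceMethod_quantitative_sum_of_tubes (ρ := μ) (T := T L z) (fun a => hTm L z a hL hz) (hdisj L z hL hz) hFm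
    (fun a => hFi.integrableOn) (ℓ := fun a => c L z a * (2 * π / β) ^ ((9 : ℝ) * (L : ℝ) ^ 4))
    (ε := fun a => K L z a / β * (c L z a * (2 * π / β) ^ ((9 : ℝ) * (L : ℝ) ^ 4)))
    (fun a => htube β L z a hβ hL hz) (Real.exp_pos _).le hout
  simpa only [hμ, probReal_univ, mul_one] using h

end Summit.QuantumFields.YangMills.Theorems.QuantitativeLaplace
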